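import Literature.MathematicalPhysics.QuantumFieldTheory.TwistedPartitionFunctionStrongCouplingRatchet
import Literature.MathematicalPhysics.QuantumFieldTheory.TwistedPartitionFunctionRPBound
import Literature.MathematicalPhysics.QuantumFieldTheory.YangMillsOS
import Literature.MathematicalPhysics.QuantumLattice.GaugeGroups
import Literature.LinearAlgebra.Matrix.ClassicalGroupsCenter
import HarnessLib

/-!
# The strong-coupling dyadic volume ratchet for EVERY plane of the symmetric four-torus, for faithful representations
# with scalar centre action, and for the fundamental representation of `SU(N)`

Topic `Literature/MathematicalPhysics/QuantumFieldTheory`; sequel of `TwistedPartitionFunctionStrongCouplingRatchet.lean`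
(`exists_beta0_twistedPartitionFunction_03_dyadic_ratchet`: plane `(0,3)`) and of `TwistedPartitionFunctionRPBound.lean` §AllPlanes
(`twistedPartitionFunction_eq_transpose_zero`: `Z(z;(μ,ν)) = Z(z;(0,ν))` by the relabelling `0 ↔ μ`).

* `twistedPartitionFunction_eq_transpose_right` — `Z(z;(0,ν)) = Z(z;(0,κ))` (`0 < ν, κ`; relabelling `ν ↔ κ` of the axes, any `d`, any
  real `β`, continuous `ρ`, any `z`); ★ `twistedPartitionFunction_eq_plane03` — on `(ℤ/L)⁴` every plane's twisted partition function equals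
  the one of the plane `(0,3)`;
* ★★★ `exists_beta0_twistedPartitionFunction_dyadic_ratchet` — compact second-countable `G`, unitary continuous `ρ : G →* M_N(ℂ)` (`N ≥ 1`),
  central `z` with `ρ(z) = ω·1`, `|ω| = 1`, `ω ≠ 1`: `∃ β₀ > 0, ∀ 0 < β ≤ β₀, ∀ q, ∀ n ≥ 1, t_z(q; 2^{n+1} − 2 + 2) ≤ t_z(q; 2^{n+2} − 2 + 2)`;
* ★★★ `LatticeRep.exists_beta0_twistedPartitionFunction_dyadic_ratchet` — the same for a faithful continuous unitary `r : LatticeRep G`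
  and a central `z ≠ 1` acting in `r` by a scalar (`|ω| = 1` and `ω ≠ 1` are then automatic);
* ★★★ `sun_fundamental_exists_beta0_dyadic_ratchet` — `SU(N)`, `N ≥ 2`, fundamental representation, EVERY central `z ≠ 1` (the centre of
  `SU(N)` consists of scalars, `mem_center_specialUnitaryGroup_iff_exists_smul_one`), every plane `q`.

HONEST FRAMING: strong coupling `β ≤ β₀(ρ, z)` only — the summit's crux `DyadicVolumeRatchet` asks this for EVERY `β > 0` and every faithful `r`
(for a reducible `r` the centre need not act by scalars); here is its strong-coupling / heavy-flux model case, nothing more.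

References: E. T. Tomboulis, L. G. Yaffe, Commun. Math. Phys. 100 (1985) 313 [TomboulisYaffe1985]; T. Kanazawa, Ann. Phys. 324 (2009) 1634
[Kanazawa2008] §2 Lemma 2; G. 't Hooft, Nucl. Phys. B153 (1979) 141 [tHooft1979Flux] §5; M. L. Curtis, Matrix Groups (1984)
[Curtis1984MatrixGroups] Ch. VII Prop. 9.
-/

noncomputable section

open MeasureTheory
open scoped BigOperators

namespace Literature.MathematicalPhysics.QuantumFieldTheory

/-! ### Relabelling two non-zero axes: `Z(z;(0,ν)) = Z(z;(0,κ))` -/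

section PlaneSymmetry

open WilsonRP

variable {d L N : ℕ} {G : Type*} [Group G]

/-- Coordinates other than the two transposed ones are unchanged. [folklore] -/
private theorem siteTranspose_apply_of_ne'' {μ ν k : Fin d} (hkμ : k ≠ μ) (hkν : k ≠ ν) (x : Site d L) :
    siteTranspose μ ν x k = x k := by
  simp [siteTranspose, Equiv.swap_apply_of_ne_of_ne hkμ hkν]

/-- Reversing the orientation of a plaquette inverts its holonomy. [folklore] -/
private theorem plaquetteHolonomy_reverse'' (U : GaugeConfig d L G) (x : Site d L) (i j : Fin d) :
    plaquetteHolonomy U x j i = (plaquetteHolonomy U x i j)⁻¹ := by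
  simp only [plaquetteHolonomy, mul_inv_rev, inv_inv, mul_assoc]

variable [NeZero d]

/-- Transporting the ordered insertion of the `(0, κ)`-stack along the transposition `ν ↔ κ` (`ν, κ ≠ 0`, `ν ≠ κ`) gives the ordered
insertion of the `(0, ν)`-stack with the same twist and stack coordinates. [folklore] -/
private theorem orderedInsertion_transpose_right (z : G) {ν κ : Fin d} (hν : (0 : Fin d) ≠ ν) (hκ : (0 : Fin d) ≠ κ)
    (a b : ZMod L) (y : Site d L) (k l : Fin d) :
    orderedInsertion z 0 κ a b (siteTranspose ν κ y) (Equiv.swap ν κ k) (Equiv.swap ν κ l) = orderedInsertion z 0 ν a b y k l := by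
  unfold orderedInsertion
  have h0 : siteTranspose ν κ y 0 = y 0 := siteTranspose_apply_of_ne'' hν hκ y
  have hκ' : siteTranspose ν κ y κ = y ν := siteTranspose_apply_right ν κ y
  have e0 : ∀ m : Fin d, Equiv.swap ν κ m = 0 ↔ m = 0 := fun m => by
    rw [Equiv.swap_apply_eq_iff, Equiv.swap_apply_of_ne_of_ne hν hκ]
  have eκ : ∀ m : Fin d, Equiv.swap ν κ m = κ ↔ m = ν := fun m => by
    rw [Equiv.swap_apply_eq_iff, Equiv.swap_apply_right]
  simp only [h0, hκ', e0, eκ]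

variable [NeZero L] [TopologicalSpace G] [IsTopologicalGroup G] [CompactSpace G] (ρ : G →* Matrix (Fin N) (Fin N) ℂ)

/-- **The twisted action under the relabelling `ν ↔ κ`** (`0 < ν`, `0 < κ`): the `(0, ν)`-twisted action of the transposed
configuration is the `(0, κ)`-twisted action of the configuration. [cite: Kanazawa2008, §2 Lemma 2 eq. (17)] -/
private theorem insertedWilsonAction_stack_configTranspose_right (hρ : Continuous ρ) (z : G) {ν κ : Fin d} (hν : (0 : Fin d) < ν)
    (hκ : (0 : Fin d) < κ) (a b : ZMod L) (U : GaugeConfig d L G) :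
    insertedWilsonAction ρ (stackInsertion z ⟨(0, ν), hν⟩ a b) (configTranspose ν κ U) =
      insertedWilsonAction ρ (stackInsertion z ⟨(0, κ), hκ⟩ a b) U := by
  set g : Site d L → Fin d → Fin d → ℝ := fun y k l =>
    (N : ℝ) - (ρ (orderedInsertion z 0 κ a b y k l * plaquetteHolonomy U y k l)).trace.re with hg
  have hsymm : ∀ y k l, g y k l = g y l k := by
    intro y k l
    simp only [hg]
    rw [orderedInsertion_swap hκ.ne z a b y k l, plaquetteHolonomy_reverse'' U y k l, re_trace_inv_mul_inv ρ hρ]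
  calc insertedWilsonAction ρ (stackInsertion z ⟨(0, ν), hν⟩ a b) (configTranspose ν κ U)
      = ∑ p : Plaquette d L, g (siteTranspose ν κ p.1) (Equiv.swap ν κ p.2.1.1) (Equiv.swap ν κ p.2.1.2) := by
        unfold insertedWilsonAction
        refine Finset.sum_congr rfl fun p _ => ?_
        simp only [hg]
        rw [plaquetteHolonomy_configTranspose, orderedInsertion_transpose_right z hν.ne hκ.ne, orderedInsertion_plaquette hν]
    _ = ∑ p : Plaquette d L, g p.1 p.2.1.1 p.2.1.2 := sum_plaquette_transpose g hsymm ν κ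
    _ = insertedWilsonAction ρ (stackInsertion z ⟨(0, κ), hκ⟩ a b) U := by
        unfold insertedWilsonAction
        refine Finset.sum_congr rfl fun p _ => ?_
        simp only [hg]
        rw [orderedInsertion_plaquette hκ]

variable [MeasurableSpace G] [BorelSpace G] (β : ℝ)

/-- **`Z(z; (0, ν)) = Z(z; (0, κ))` for `0 < ν, κ`** (every real `β`, every `z`, continuous `ρ`, every `d`, `L`): the relabelling `ν ↔ κ` of
the axes — the remaining symmetry behind «for every plane» (with `twistedPartitionFunction_eq_transpose_zero`).
[cite: Kanazawa2008, §2 Lemma 2 eq. (17)] -/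
theorem twistedPartitionFunction_eq_transpose_right (hρ : Continuous ρ) (z : G) {ν κ : Fin d} (hν : (0 : Fin d) < ν)
    (hκ : (0 : Fin d) < κ) :
    twistedPartitionFunction ρ β L z ⟨(0, ν), hν⟩ = twistedPartitionFunction ρ β L z ⟨(0, κ), hκ⟩ := by
  rw [twistedPartitionFunction_eq_at, twistedPartitionFunction_eq_at, twistedPartitionFunctionAt_eq_inserted,
    twistedPartitionFunctionAt_eq_inserted]
  unfold insertedPartitionFunction
  calc ∫ U : GaugeConfig d L G, Real.exp (-(β * insertedWilsonAction ρ (stackInsertion z ⟨(0, ν), hν⟩ 0 0) U))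
          ∂(Measure.pi fun _ : Edge d L => haarProbability G)
      = ∫ U : GaugeConfig d L G, Real.exp (-(β * insertedWilsonAction ρ (stackInsertion z ⟨(0, ν), hν⟩ 0 0)
          (configTransposeEquiv ν κ U))) ∂(Measure.pi fun _ : Edge d L => haarProbability G) :=
        ((measurePreserving_configTransposeEquiv ν κ).integral_comp'
          (fun V : GaugeConfig d L G => Real.exp (-(β * insertedWilsonAction ρ (stackInsertion z ⟨(0, ν), hν⟩ 0 0) V)))).symm
    _ = ∫ U : GaugeConfig d L G, Real.exp (-(β * insertedWilsonAction ρ (stackInsertion z ⟨(0, κ), hκ⟩ 0 0) U))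
          ∂(Measure.pi fun _ : Edge d L => haarProbability G) := by
        simp only [configTransposeEquiv_apply, insertedWilsonAction_stack_configTranspose_right ρ hρ z hν hκ]

/-- **★ On `(ℤ/L)⁴` every plane is the plane `(0,3)`**: `Z(z; q) = Z(z; (0,3))` for every plane `q`, real `β`, continuous `ρ`, any `z`
(`(μ,ν) ↦ (0,ν)` by `0 ↔ μ`, then `(0,ν) ↦ (0,3)` by `ν ↔ 3`). [cite: Kanazawa2008, §2 Lemma 2 eq. (17)] -/
theorem twistedPartitionFunction_eq_plane03 {L : ℕ} [NeZero L] (hρ : Continuous ρ) (z : G) (q : {p : Fin 4 × Fin 4 // p.1 < p.2}) :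
    twistedPartitionFunction ρ β L z q =
      twistedPartitionFunction ρ β L z (⟨((0 : Fin 4), (3 : Fin 4)), by decide⟩ : {p : Fin 4 × Fin 4 // p.1 < p.2}) := by
  obtain ⟨⟨μ, ν⟩, hμν⟩ := q
  by_cases hμ : μ = 0
  · subst hμ
    exact twistedPartitionFunction_eq_transpose_right ρ β hρ z hμν (by decide)
  · have hμ' : (0 : Fin 4) < μ := by
      rw [Fin.lt_def, Fin.val_zero]
      exact Nat.pos_of_ne_zero fun h => hμ (Fin.ext (by rw [h, Fin.val_zero]))
    change twistedPartitionFunction ρ β L z ⟨(μ, ν), hμν⟩ = _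
    rw [twistedPartitionFunction_eq_transpose_zero ρ β hρ z hμ' hμν]
    exact twistedPartitionFunction_eq_transpose_right ρ β hρ z (hμ'.trans hμν) (by decide)

end PlaneSymmetry

/-! ### The ratchet for every plane -/

section AllPlanes

variable {G : Type*} [Group G] [TopologicalSpace G] [IsTopologicalGroup G] [CompactSpace G] [MeasurableSpace G] [BorelSpace G]

/-- **★★★ 't Hooft's dyadic volume ratchet at strong coupling, every plane, scalar twist.**  For second-countable compact `G`, unitary
continuous `ρ : G →* M_N(ℂ)` (`N ≥ 1`), central `z` with `ρ(z) = ω·1`, `|ω| = 1`, `ω ≠ 1`: there is `β₀ = β₀(ρ, ω) > 0` (explicit, see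
`exists_beta0_twistedPartitionFunction_03_dyadic_ratchet`) such that for all `0 < β ≤ β₀`, every plane `q` of the four-torus and every
`n ≥ 1`: `Z_z(q; 2^{n+1})/Z_1(q; 2^{n+1}) ≤ Z_z(q; 2^{n+2})/Z_1(q; 2^{n+2})`.
[cite: TomboulisYaffe1985, App. I and §2 eqs. (2.10)–(2.12)] [cite: Kanazawa2008, §2 Lemma 2 eq. (17)] [cite: tHooft1979Flux, §5] -/
theorem exists_beta0_twistedPartitionFunction_dyadic_ratchet [SecondCountableTopology G] {N : ℕ} (ρ : G →* Matrix (Fin N) (Fin N) ℂ)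
    (hρu : ∀ g, ρ g ∈ Matrix.unitaryGroup (Fin N) ℂ) (hρ : Continuous ρ) (hN : 1 ≤ N) {z : G} (hz : z ∈ Subgroup.center G) {ω : ℂ}
    (hω : ρ z = ω • (1 : Matrix (Fin N) (Fin N) ℂ)) (hω1 : ‖ω‖ = 1) (hne : ω ≠ 1) :
    ∃ β₀ : ℝ, 0 < β₀ ∧ ∀ β : ℝ, 0 < β → β ≤ β₀ → ∀ q : {p : Fin 4 × Fin 4 // p.1 < p.2}, ∀ n : ℕ, 1 ≤ n →
      twistedPartitionFunction ρ β (2 ^ (n + 1) - 2 + 2) z q / twistedPartitionFunction ρ β (2 ^ (n + 1) - 2 + 2) 1 q ≤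
        twistedPartitionFunction ρ β (2 ^ (n + 2) - 2 + 2) z q / twistedPartitionFunction ρ β (2 ^ (n + 2) - 2 + 2) 1 q := by
  obtain ⟨β₀, hβ₀, h⟩ := exists_beta0_twistedPartitionFunction_03_dyadic_ratchet ρ hρu hρ hN hz hω hω1 hne
  refine ⟨β₀, hβ₀, fun β hβ0 hβ q n hn => ?_⟩
  rw [twistedPartitionFunction_eq_plane03 ρ β hρ z q, twistedPartitionFunction_eq_plane03 ρ β hρ 1 q,
    twistedPartitionFunction_eq_plane03 ρ β hρ z q, twistedPartitionFunction_eq_plane03 ρ β hρ 1 q]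
  exact h β hβ0 hβ n hn

omit [IsTopologicalGroup G] [CompactSpace G] [MeasurableSpace G] [BorelSpace G] in
/-- A non-trivial element is mapped to a non-identity matrix by a faithful representation, so `N ≥ 1`. [folklore] -/
private theorem LatticeRep.one_le_N (r : LatticeRep G) {z : G} (hz1 : z ≠ 1) : 1 ≤ r.N := by
  by_contra h
  have hN : r.N = 0 := by omega
  apply hz1
  apply r.injective
  ext i j
  exact (Fin.elim0 (hN ▸ i : Fin 0))

omit [IsTopologicalGroup G] [CompactSpace G] [MeasurableSpace G] [BorelSpace G] in
/-- If a central `z ≠ 1` acts in a faithful representation by the scalar `ω`, then `ω ≠ 1`. [folklore] -/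
private theorem LatticeRep.scalar_ne_one (r : LatticeRep G) {z : G} (hz1 : z ≠ 1) {ω : ℂ}
    (hω : r.ρ z = ω • (1 : Matrix (Fin r.N) (Fin r.N) ℂ)) : ω ≠ 1 := by
  rintro rfl
  rw [one_smul] at hω
  exact hz1 (r.injective (hω.trans (map_one r.ρ).symm))

omit [IsTopologicalGroup G] [CompactSpace G] [MeasurableSpace G] [BorelSpace G] in
/-- If `z` acts in a unitary representation by the scalar `ω` (and `z ≠ 1`, so `N ≥ 1`), then `|ω| = 1`. [folklore] -/
private theorem LatticeRep.norm_scalar_eq_one (r : LatticeRep G) {z : G} (hz1 : z ≠ 1) {ω : ℂ}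
    (hω : r.ρ z = ω • (1 : Matrix (Fin r.N) (Fin r.N) ℂ)) : ‖ω‖ = 1 := by
  have hN := r.one_le_N hz1
  have hu := r.mem_unitary z
  rw [hω, Matrix.mem_unitaryGroup_iff] at hu
  -- `(ω•1) * star (ω•1) = (conj ω * ω) • 1`
  have h' : (star ω * ω) • (1 : Matrix (Fin r.N) (Fin r.N) ℂ) = 1 := by
    rw [star_smul, star_one, Matrix.mul_smul, Matrix.mul_one, smul_smul] at hu
    exact hu
  have h00 := congr_fun (congr_fun h' ⟨0, hN⟩) ⟨0, hN⟩
  rw [Matrix.smul_apply, Matrix.one_apply_eq, smul_eq_mul, mul_one, mul_comm, Complex.star_def, Complex.mul_conj] at h00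
  have hns : Complex.normSq ω = 1 := by exact_mod_cast h00
  rw [Complex.normSq_eq_norm_sq] at hns
  exact (pow_eq_one_iff_of_nonneg (norm_nonneg ω) two_ne_zero).1 hns

/-- **★★★ The ratchet for a faithful continuous unitary representation with scalar centre action.**  For compact `G`, `r : LatticeRep G`
(faithful, continuous, unitary — `G` is then second countable), a central `z ≠ 1` with `r.ρ(z) = ω·1`: `∃ β₀ > 0, ∀ 0 < β ≤ β₀, ∀ q, ∀ n ≥ 1,
Z_z(q; 2^{n+1})/Z_1(q; 2^{n+1}) ≤ Z_z(q; 2^{n+2})/Z_1(q; 2^{n+2})`.  The scalar-action hypothesis holds for every irreducible `r` (Schur) and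
in particular for the fundamental representation of `SU(N)`; it can fail for a reducible faithful `r`.
[cite: TomboulisYaffe1985, App. I and §2 eqs. (2.10)–(2.12)] [cite: tHooft1979Flux, §5] -/
theorem LatticeRep.exists_beta0_twistedPartitionFunction_dyadic_ratchet (r : LatticeRep G) {z : G} (hz : z ∈ Subgroup.center G)
    (hz1 : z ≠ 1) {ω : ℂ} (hω : r.ρ z = ω • (1 : Matrix (Fin r.N) (Fin r.N) ℂ)) :
    ∃ β₀ : ℝ, 0 < β₀ ∧ ∀ β : ℝ, 0 < β → β ≤ β₀ → ∀ q : {p : Fin 4 × Fin 4 // p.1 < p.2}, ∀ n : ℕ, 1 ≤ n →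
      twistedPartitionFunction r.ρ β (2 ^ (n + 1) - 2 + 2) z q / twistedPartitionFunction r.ρ β (2 ^ (n + 1) - 2 + 2) 1 q ≤
        twistedPartitionFunction r.ρ β (2 ^ (n + 2) - 2 + 2) z q / twistedPartitionFunction r.ρ β (2 ^ (n + 2) - 2 + 2) 1 q := by
  haveI : SecondCountableTopology G := (r.continuous.isClosedEmbedding r.injective).isEmbedding.secondCountableTopology
  exact Literature.MathematicalPhysics.QuantumFieldTheory.exists_beta0_twistedPartitionFunction_dyadic_ratchet r.ρ r.mem_unitary
    r.continuous (r.one_le_N hz1) hz hω (r.norm_scalar_eq_one hz1 hω) (r.scalar_ne_one hz1 hω)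

/-- **★★★ `SU(N)`, fundamental representation, every central `z ≠ 1`, every plane — at strong coupling.**  For `N ≥ 2` and every central
`z ≠ 1` of `SU(N)` (a scalar `ω·1`, `ω^N = 1`, by Curtis' Prop. VII.9) there is `β₀ = β₀(N, z) > 0` such that for all `0 < β ≤ β₀`, every
plane `q` and every `n ≥ 1` the single-plane vortex ratio of the symmetric four-torus in the fundamental representation does not decrease
from side `2^{n+1}` to side `2^{n+2}`.  This is the summit crux's `DyadicVolumeRatchet` for `r =` fundamental, RESTRICTED to `β ≤ β₀(N, z)`
(the crux asks every `β > 0`). [cite: TomboulisYaffe1985, App. I and §2 eqs. (2.10)–(2.12)] [cite: Curtis1984MatrixGroups, Ch. VII §C Prop. 9]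
[cite: tHooft1979Flux, §5] -/
theorem sun_fundamental_exists_beta0_dyadic_ratchet {N : ℕ} (hN : 2 ≤ N) {z : Matrix.specialUnitaryGroup (Fin N) ℂ}
    (hz : z ∈ Subgroup.center (Matrix.specialUnitaryGroup (Fin N) ℂ)) (hz1 : z ≠ 1) :
    ∃ β₀ : ℝ, 0 < β₀ ∧ ∀ β : ℝ, 0 < β → β ≤ β₀ → ∀ q : {p : Fin 4 × Fin 4 // p.1 < p.2}, ∀ n : ℕ, 1 ≤ n →
      twistedPartitionFunction (Literature.MathematicalPhysics.QuantumLattice.fundamentalRep (Fin N)) β (2 ^ (n + 1) - 2 + 2) z q /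
          twistedPartitionFunction (Literature.MathematicalPhysics.QuantumLattice.fundamentalRep (Fin N)) β (2 ^ (n + 1) - 2 + 2) 1 q ≤
        twistedPartitionFunction (Literature.MathematicalPhysics.QuantumLattice.fundamentalRep (Fin N)) β (2 ^ (n + 2) - 2 + 2) z q /
          twistedPartitionFunction (Literature.MathematicalPhysics.QuantumLattice.fundamentalRep (Fin N)) β (2 ^ (n + 2) - 2 + 2) 1 q := by
  obtain ⟨ω, hωN, hω⟩ := Literature.LinearAlgebra.Matrix.mem_center_specialUnitaryGroup_iff_exists_smul_one.1 hz
  have hρz : Literature.MathematicalPhysics.QuantumLattice.fundamentalRep (Fin N) z = ω • (1 : Matrix (Fin N) (Fin N) ℂ) := by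
    rw [Literature.MathematicalPhysics.QuantumLattice.fundamentalRep_apply, hω]
  have hne : ω ≠ 1 := by
    rintro rfl
    rw [one_smul] at hω
    exact hz1 (Subtype.ext hω)
  have hω1 : ‖ω‖ = 1 := by
    have h : ‖ω‖ ^ Fintype.card (Fin N) = 1 := by rw [← norm_pow, hωN, norm_one]
    rw [Fintype.card_fin] at h
    exact (pow_eq_one_iff_of_nonneg (norm_nonneg ω) (by omega)).1 h
  exact exists_beta0_twistedPartitionFunction_dyadic_ratchet (Literature.MathematicalPhysics.QuantumLattice.fundamentalRep (Fin N))
    Literature.MathematicalPhysics.QuantumLattice.fundamentalRep_mem_unitaryGroup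
    (Literature.MathematicalPhysics.QuantumLattice.continuous_fundamentalRep (Fin N)) (by omega) hz hρz hω1 hne

end AllPlanes

end Literature.MathematicalPhysics.QuantumFieldTheory
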